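import Literature.AlgebraicGeometry.Frobenioids.ArchimedeanFSM
import Literature.AlgebraicGeometry.Frobenioids.ArchimedeanFrobenioidStatements
import Literature.AlgebraicGeometry.Frobenioids.ArchimedeanIsotropy
import HarnessLib

/-!
# Frobenioids II, Proposition 3.4 (v): PROOF of the irreducibility criterion
# (abc-iut cell, layer L1, node `FrdII:Prop3.4(v)`, sub-node `FrdII:Prop3.4(v)/P34-L06`, chain LC-L1-2)

Mochizuki, *The geometry of Frobenioids II: poly-Frobenioids*, Kyushu J. Math. **62** (2008)
401–460, §3, Proposition 3.4 (v) p. 30, proof p. 31 ll. 25–27 [cite: MochizukiFrdII2008, Prop 3.4 (v) p.30].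
PROOF-ONLY companion of `ArchimedeanFSM.lean` (statements, seat abc-iut-L1-t6); nothing is defined here.

> "(v) Any morphism of `F` that projects to an irreducible morphism (respectively, isomorphism;
> irreducible morphism) of `D`, to an isomorphism (respectively, irreducible morphism; irreducible
> morphism) of `F₀`, and to a(n) isomorphism (respectively, isomorphism; non-isomorphism) of `D₀` is an
> irreducible morphism of `F`."  Proof (p. 31): "since `F₀` and `D` are totally epimorphic, if a
> composite is an isomorphism then so are its factors; now (v) follows from the three projection patterns."

What is PROVED here, for `F = A, N, R` (`towerA`, `towerN`, `towerR`):
* a generic criterion `Tower.propV_of_isIso_criteria`: item (v) holds for ANY tower in which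
  (a) in `F₀`, the factors of an invertible composite are invertible; (b) the same in `D`;
  (c) an arrow of `F` whose projections to `D` and to `F₀` are isomorphisms is an isomorphism;
  (d) if the projection to `F₀` of an arrow lies over an isomorphism of `D₀` then so does the arrow;
* the tower facts (c), (d) for `A`, `N`, `R` (`C = C₀ ×_{D₀} D` detects isomorphisms componentwise,
  `CFP.isIso_of_isIso_fst_snd`; inverses of isometries are isometries, `C.isIsometry_inv`; inverses of
  linear arrows are linear), and (a) for `A₀`, `N₀`, `R₀` (totally epimorphic, from `C0.isTotallyEpimorphic`);
* hence **`prop34_v_of_isTotallyEpimorphic : IsTotallyEpimorphic D → Prop34_v π`** — item (v) under the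
  standing hypothesis of Ex. 3.3 (i) that `D` is totally epimorphic (p. 27 "Let `D` be a connected,
  totally epimorphic category"), which the typed node statement `Prop34_v π` does not bind;
* for the record, the two projection patterns that need NO hypothesis on `D`: the first
  (`D`-irreducible, `F₀`-iso) and the third (`D`- and `F₀`-irreducible, `D₀`-non-iso) —
  `Tower.isIrreducibleHom_of_fst_pattern`, `Tower.isIrreducibleHom_of_third_pattern` and their
  instances for `A`, `N`, `R`. Only the second pattern (`D`-iso, `F₀`-irreducible) uses the total
  epimorphicity of `D`.
No statement of the paper is strengthened; no side is taken on [IUTchIII] Cor. 3.12.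
-/

namespace Literature.AlgebraicGeometry.Frobenioids

open CategoryTheory

namespace ArchFrd

universe v u

/-! ### Generic: item (v) for a tower from four elementary criteria -/

namespace Tower

variable {D : Type u} [Category.{v} D] {π : D ⥤ D0} (T : Tower π)

/-- **Prop. 3.4 (v), first projection pattern**, for any tower satisfying (a) "in `F₀` the factors of an
invertible composite are invertible" and (c) "isomorphisms of `F` are detected by the projections to
`D` and `F₀`": an arrow projecting to an irreducible arrow of `D` and to an isomorphism of `F₀` is
irreducible (no hypothesis on `D`, none on the projection to `D₀`).
[cite: MochizukiFrdII2008, Prop 3.4 (v) p.30] -/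
theorem isIrreducibleHom_of_fst_pattern
    (h0 : ∀ ⦃X Y Z : T.F0⦄ (β : X ⟶ Y) (α : Y ⟶ Z), IsIso (β ≫ α) → IsIso α ∧ IsIso β)
    (hrefl : ∀ ⦃X Y : T.F⦄ (φ : X ⟶ Y), IsIso (T.toD.map φ) → IsIso (T.toF0.map φ) → IsIso φ)
    {X Y : T.F} (φ : X ⟶ Y) (hD' : IsIrreducibleHom (T.toD.map φ)) (hF : IsIso (T.toF0.map φ)) :
    IsIrreducibleHom φ := by
  refine ⟨fun hφ => hD'.1 (by haveI := hφ; infer_instance), fun E β α hfac => ?_⟩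
  have hF' : IsIso (T.toF0.map β ≫ T.toF0.map α) := by
    rw [← Functor.map_comp, hfac]; exact hF
  obtain ⟨hα0, hβ0⟩ := h0 _ _ hF'
  rcases hD'.2 (T.toD.map β) (T.toD.map α) (by rw [← Functor.map_comp, hfac]) with hαD | hβD
  · exact Or.inl (hrefl α hαD hα0)
  · exact Or.inr (hrefl β hβD hβ0)

/-- **Prop. 3.4 (v), second projection pattern**, for any tower satisfying (b) "in `D` the factors of an
invertible composite are invertible" (e.g. `D` totally epimorphic, [FrdI] §0 p. 16) and (c): an arrow
projecting to an isomorphism of `D` and to an irreducible arrow of `F₀` is irreducible.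
[cite: MochizukiFrdII2008, Prop 3.4 (v) p.30] -/
theorem isIrreducibleHom_of_snd_pattern
    (hD : ∀ ⦃X Y Z : D⦄ (β : X ⟶ Y) (α : Y ⟶ Z), IsIso (β ≫ α) → IsIso α ∧ IsIso β)
    (hrefl : ∀ ⦃X Y : T.F⦄ (φ : X ⟶ Y), IsIso (T.toD.map φ) → IsIso (T.toF0.map φ) → IsIso φ)
    {X Y : T.F} (φ : X ⟶ Y) (hD' : IsIso (T.toD.map φ)) (hF : IsIrreducibleHom (T.toF0.map φ)) :
    IsIrreducibleHom φ := by
  refine ⟨fun hφ => hF.1 (by haveI := hφ; infer_instance), fun E β α hfac => ?_⟩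
  have hDc : IsIso (T.toD.map β ≫ T.toD.map α) := by
    rw [← Functor.map_comp, hfac]; exact hD'
  obtain ⟨hαD, hβD⟩ := hD _ _ hDc
  rcases hF.2 (T.toF0.map β) (T.toF0.map α) (by rw [← Functor.map_comp, hfac]) with hα0 | hβ0
  · exact Or.inl (hrefl α hαD hα0)
  · exact Or.inr (hrefl β hβD hβ0)

/-- **Prop. 3.4 (v), third projection pattern**, for any tower satisfying (c) and (d) "an arrow whose
projection to `F₀` lies over an isomorphism of `D₀` lies over an isomorphism of `D₀`": an arrow
projecting to irreducible arrows of `D` and of `F₀` and to a NON-isomorphism of `D₀` is irreducible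
(the mixed cases "`α_D` and `β₀` invertible" are excluded because they would make `φ_{D₀}` invertible;
no hypothesis on `D`). [cite: MochizukiFrdII2008, Prop 3.4 (v) p.30] -/
theorem isIrreducibleHom_of_third_pattern
    (hrefl : ∀ ⦃X Y : T.F⦄ (φ : X ⟶ Y), IsIso (T.toD.map φ) → IsIso (T.toF0.map φ) → IsIso φ)
    (hcompat : ∀ ⦃X Y : T.F⦄ (φ : X ⟶ Y), IsIso (T.base0.map (T.toF0.map φ)) → IsIso (T.toD0.map φ))
    {X Y : T.F} (φ : X ⟶ Y) (hD' : IsIrreducibleHom (T.toD.map φ))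
    (hF : IsIrreducibleHom (T.toF0.map φ)) (hD0 : ¬ IsIso (T.toD0.map φ)) :
    IsIrreducibleHom φ := by
  refine ⟨fun hφ => hD'.1 (by haveI := hφ; infer_instance), fun E β α hfac => ?_⟩
  have hfac0 : T.toD0.map β ≫ T.toD0.map α = T.toD0.map φ := by rw [← Functor.map_comp, hfac]
  rcases hD'.2 (T.toD.map β) (T.toD.map α) (by rw [← Functor.map_comp, hfac]) with hαD | hβD <;>
    rcases hF.2 (T.toF0.map β) (T.toF0.map α) (by rw [← Functor.map_comp, hfac]) with hα0 | hβ0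
  · exact Or.inl (hrefl α hαD hα0)
  · exfalso
    apply hD0
    haveI : IsIso (T.toD0.map α) := by
      change IsIso (π.map (T.toD.map α)); haveI := hαD; infer_instance
    haveI : IsIso (T.toD0.map β) := hcompat β (by haveI := hβ0; infer_instance)
    rw [← hfac0]; infer_instance
  · exfalso
    apply hD0
    haveI : IsIso (T.toD0.map β) := by
      change IsIso (π.map (T.toD.map β)); haveI := hβD; infer_instance
    haveI : IsIso (T.toD0.map α) := hcompat α (by haveI := hα0; infer_instance)
    rw [← hfac0]; infer_instance
  · exact Or.inr (hrefl β hβD hβ0)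

/-- **Prop. 3.4 (v) for a tower** from the four criteria (a)–(d) of this file's header.
[cite: MochizukiFrdII2008, Prop 3.4 (v) p.30] -/
theorem propV_of_isIso_criteria
    (h0 : ∀ ⦃X Y Z : T.F0⦄ (β : X ⟶ Y) (α : Y ⟶ Z), IsIso (β ≫ α) → IsIso α ∧ IsIso β)
    (hD : ∀ ⦃X Y Z : D⦄ (β : X ⟶ Y) (α : Y ⟶ Z), IsIso (β ≫ α) → IsIso α ∧ IsIso β)
    (hrefl : ∀ ⦃X Y : T.F⦄ (φ : X ⟶ Y), IsIso (T.toD.map φ) → IsIso (T.toF0.map φ) → IsIso φ)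
    (hcompat : ∀ ⦃X Y : T.F⦄ (φ : X ⟶ Y), IsIso (T.base0.map (T.toF0.map φ)) → IsIso (T.toD0.map φ)) :
    T.PropV := fun _ _ φ =>
  ⟨fun hD' hF _ => T.isIrreducibleHom_of_fst_pattern h0 hrefl φ hD' hF,
    fun hD' hF _ => T.isIrreducibleHom_of_snd_pattern hD hrefl φ hD' hF,
    fun hD' hF hD0 => T.isIrreducibleHom_of_third_pattern hrefl hcompat φ hD' hF hD0⟩

end Tower

/-- "if `C` is a totally epimorphic category, and `α ∘ β` is an isomorphism, then `α`, `β` are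
isomorphisms" ([FrdI] §0 p. 16), in the shape used by the criteria above.
[cite: MochizukiFrdI2008, §0 p.16] -/
theorem isIso_and_isIso_of_isIso_comp {E : Type*} [Category E] (hE : IsTotallyEpimorphic E)
    ⦃X Y Z : E⦄ (β : X ⟶ Y) (α : Y ⟶ Z) (h : IsIso (β ≫ α)) : IsIso α ∧ IsIso β := by
  haveI := h
  exact hE.isIso_of_isIso_comp β α

variable {D : Type u} [Category.{v} D] (π : D ⥤ D0)

/-! ### The criteria for `F = A` -/

/-- (c) for `A`: an arrow of `A` whose projections to `D` and to `A₀` are isomorphisms is an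
isomorphism (componentwise in `C₀ ×_{D₀} D`; the inverse is again an isometry).
[cite: MochizukiFrdII2008, Prop 3.4 (v) p.30] -/
theorem A.isIso_of_isIso_proj {X Y : A π} (φ : X ⟶ Y) (hD : IsIso ((towerA π).toD.map φ))
    (h0 : IsIso ((towerA π).toF0.map φ)) : IsIso φ := by
  haveI : IsIso φ.hom.snd := hD
  haveI : IsIso φ.hom.fst := (A0.ι.mapIso (@asIso _ _ _ _ _ h0)).isIso_hom
  haveI : IsIso φ.hom := CFP.isIso_of_isIso_fst_snd φ.hom
  exact ⟨⟨⟨inv φ.hom, C.isIsometry_inv π φ.hom⟩, WideSubcategory.hom_ext _ (IsIso.hom_inv_id φ.hom),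
    WideSubcategory.hom_ext _ (IsIso.inv_hom_id φ.hom)⟩⟩

/-- (d) for `A`: the compatibility square of `C₀ ×_{D₀} D` — `Base(φ₀) ∘`(identification) `=`
(identification) `∘ π(φ_D)` — shows that `φ` lies over an isomorphism of `D₀` as soon as `φ₀` does.
[cite: MochizukiFrdII2008, Prop 3.4 (v) p.30] -/
theorem A.isIso_toD0_of_isIso_base0 {X Y : A π} (φ : X ⟶ Y)
    (h : IsIso ((towerA π).base0.map ((towerA π).toF0.map φ))) : IsIso ((towerA π).toD0.map φ) := by
  haveI : IsIso ((PreFrobenioid.baseFunctor C0.toElem).map φ.hom.fst) := h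
  have w : X.obj.iso.inv ≫ ((PreFrobenioid.baseFunctor C0.toElem).map φ.hom.fst ≫ Y.obj.iso.hom) =
      π.map φ.hom.snd := by
    rw [φ.hom.w, Iso.inv_hom_id_assoc]
  change IsIso (π.map φ.hom.snd)
  rw [← w]
  infer_instance

/-- (a) for `A₀`: `A₀` is totally epimorphic. [cite: MochizukiFrdII2008, Ex 3.3 (iii) p.28] -/
theorem A0.isTotallyEpimorphic' : IsTotallyEpimorphic A0 :=
  isTotallyEpimorphic_wideSubcategory _ C0.isTotallyEpimorphic

/-- **Prop. 3.4 (v), first pattern, for `A`** — unconditional in `D`.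
[cite: MochizukiFrdII2008, Prop 3.4 (v) p.30] -/
theorem A.isIrreducibleHom_of_fst_pattern {X Y : A π} (φ : X ⟶ Y)
    (hD' : IsIrreducibleHom ((towerA π).toD.map φ)) (hF : IsIso ((towerA π).toF0.map φ)) :
    IsIrreducibleHom φ :=
  (towerA π).isIrreducibleHom_of_fst_pattern (isIso_and_isIso_of_isIso_comp A0.isTotallyEpimorphic')
    (fun _ _ ψ => A.isIso_of_isIso_proj π ψ) φ hD' hF

/-- **Prop. 3.4 (v), third pattern, for `A`** — unconditional in `D`.
[cite: MochizukiFrdII2008, Prop 3.4 (v) p.30] -/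
theorem A.isIrreducibleHom_of_third_pattern {X Y : A π} (φ : X ⟶ Y)
    (hD' : IsIrreducibleHom ((towerA π).toD.map φ)) (hF : IsIrreducibleHom ((towerA π).toF0.map φ))
    (hD0 : ¬ IsIso ((towerA π).toD0.map φ)) : IsIrreducibleHom φ :=
  (towerA π).isIrreducibleHom_of_third_pattern (fun _ _ ψ => A.isIso_of_isIso_proj π ψ)
    (fun _ _ ψ => A.isIso_toD0_of_isIso_base0 π ψ) φ hD' hF hD0

/-- **Proposition 3.4 (v) for `F = A`**, for a totally epimorphic base category `D` (standing
hypothesis of Ex. 3.3 (i), p. 27). [cite: MochizukiFrdII2008, Prop 3.4 (v) p.30] -/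
theorem A.propV (hD : IsTotallyEpimorphic D) : (towerA π).PropV :=
  (towerA π).propV_of_isIso_criteria (isIso_and_isIso_of_isIso_comp A0.isTotallyEpimorphic')
    (isIso_and_isIso_of_isIso_comp hD) (fun _ _ ψ => A.isIso_of_isIso_proj π ψ)
    (fun _ _ ψ => A.isIso_toD0_of_isIso_base0 π ψ)

/-! ### The criteria for `F = N` -/

/-- (c) for `N`: an arrow of `N` whose projections to `D` and to `N₀` are isomorphisms is an
isomorphism (its underlying arrow of `A` is one, and the inverse of a linear arrow is linear).
[cite: MochizukiFrdII2008, Prop 3.4 (v) p.30] -/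
theorem N.isIso_of_isIso_proj {X Y : N π} (φ : X ⟶ Y) (hD : IsIso ((towerN π).toD.map φ))
    (h0 : IsIso ((towerN π).toF0.map φ)) : IsIso φ := by
  haveI : IsIso φ.hom := by
    exact A.isIso_of_isIso_proj π φ.hom hD (N0.ι.mapIso (@asIso _ _ _ _ _ h0)).isIso_hom
  have hlin : C0.degFr φ.hom.hom.fst = 1 := φ.property
  have hinv : PreFrobenioid.linearMorphisms (A.toElem π) (inv φ.hom) := by
    change C0.degFr (inv φ.hom).hom.fst = 1
    have h := congrArg (fun g : X.obj ⟶ X.obj => C0.degFr g.hom.fst) (IsIso.hom_inv_id φ.hom)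
    change C0.degFr φ.hom.hom.fst * C0.degFr (inv φ.hom).hom.fst = 1 at h
    rwa [hlin, one_mul] at h
  exact ⟨⟨⟨inv φ.hom, hinv⟩, WideSubcategory.hom_ext _ (IsIso.hom_inv_id φ.hom),
    WideSubcategory.hom_ext _ (IsIso.inv_hom_id φ.hom)⟩⟩

/-- (d) for `N`. [cite: MochizukiFrdII2008, Prop 3.4 (v) p.30] -/
theorem N.isIso_toD0_of_isIso_base0 {X Y : N π} (φ : X ⟶ Y)
    (h : IsIso ((towerN π).base0.map ((towerN π).toF0.map φ))) : IsIso ((towerN π).toD0.map φ) :=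
  A.isIso_toD0_of_isIso_base0 π φ.hom h

/-- (a) for `N₀`: `N₀` is totally epimorphic. [cite: MochizukiFrdII2008, Ex 3.3 (iii) p.29] -/
theorem N0.isTotallyEpimorphic' : IsTotallyEpimorphic N0 :=
  isTotallyEpimorphic_wideSubcategory _ A0.isTotallyEpimorphic'

/-- **Prop. 3.4 (v), first pattern, for `N`** — unconditional in `D`.
[cite: MochizukiFrdII2008, Prop 3.4 (v) p.30] -/
theorem N.isIrreducibleHom_of_fst_pattern {X Y : N π} (φ : X ⟶ Y)
    (hD' : IsIrreducibleHom ((towerN π).toD.map φ)) (hF : IsIso ((towerN π).toF0.map φ)) :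
    IsIrreducibleHom φ :=
  (towerN π).isIrreducibleHom_of_fst_pattern (isIso_and_isIso_of_isIso_comp N0.isTotallyEpimorphic')
    (fun _ _ ψ => N.isIso_of_isIso_proj π ψ) φ hD' hF

/-- **Prop. 3.4 (v), third pattern, for `N`** — unconditional in `D`.
[cite: MochizukiFrdII2008, Prop 3.4 (v) p.30] -/
theorem N.isIrreducibleHom_of_third_pattern {X Y : N π} (φ : X ⟶ Y)
    (hD' : IsIrreducibleHom ((towerN π).toD.map φ)) (hF : IsIrreducibleHom ((towerN π).toF0.map φ))
    (hD0 : ¬ IsIso ((towerN π).toD0.map φ)) : IsIrreducibleHom φ :=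
  (towerN π).isIrreducibleHom_of_third_pattern (fun _ _ ψ => N.isIso_of_isIso_proj π ψ)
    (fun _ _ ψ => N.isIso_toD0_of_isIso_base0 π ψ) φ hD' hF hD0

/-- **Proposition 3.4 (v) for `F = N`**, for a totally epimorphic base category `D`.
[cite: MochizukiFrdII2008, Prop 3.4 (v) p.30] -/
theorem N.propV (hD : IsTotallyEpimorphic D) : (towerN π).PropV :=
  (towerN π).propV_of_isIso_criteria (isIso_and_isIso_of_isIso_comp N0.isTotallyEpimorphic')
    (isIso_and_isIso_of_isIso_comp hD) (fun _ _ ψ => N.isIso_of_isIso_proj π ψ)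
    (fun _ _ ψ => N.isIso_toD0_of_isIso_base0 π ψ)

/-! ### The criteria for `F = R` -/

/-- (c) for `R = R₀ ×_{D₀} D`: isomorphisms are detected componentwise.
[cite: MochizukiFrdII2008, Prop 3.4 (v) p.30] -/
theorem R.isIso_of_isIso_proj {X Y : R π} (φ : X ⟶ Y) (hD : IsIso ((towerR π).toD.map φ))
    (h0 : IsIso ((towerR π).toF0.map φ)) : IsIso φ := by
  haveI : IsIso φ.snd := hD
  haveI : IsIso φ.fst := h0
  exact CFP.isIso_of_isIso_fst_snd φ

/-- (d) for `R`: the compatibility square of `R₀ ×_{D₀} D`. [cite: MochizukiFrdII2008, Prop 3.4 (v) p.30] -/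
theorem R.isIso_toD0_of_isIso_base0 {X Y : R π} (φ : X ⟶ Y)
    (h : IsIso ((towerR π).base0.map ((towerR π).toF0.map φ))) : IsIso ((towerR π).toD0.map φ) := by
  haveI : IsIso (R0.toD0.map φ.fst) := h
  have w : X.iso.inv ≫ (R0.toD0.map φ.fst ≫ Y.iso.hom) = π.map φ.snd := by
    rw [φ.w, Iso.inv_hom_id_assoc]
  change IsIso (π.map φ.snd)
  rw [← w]
  infer_instance

/-- (a) for `R₀`: `R₀ = (N₀)_{[ℝ-unit]}` is totally epimorphic. [cite: MochizukiFrdII2008, Ex 3.3 (iv) p.29] -/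
theorem R0.isTotallyEpimorphic' : IsTotallyEpimorphic R0 :=
  isTotallyEpimorphic_over N0.isTotallyEpimorphic' _

/-- **Prop. 3.4 (v), first pattern, for `R`** — unconditional in `D`.
[cite: MochizukiFrdII2008, Prop 3.4 (v) p.30] -/
theorem R.isIrreducibleHom_of_fst_pattern {X Y : R π} (φ : X ⟶ Y)
    (hD' : IsIrreducibleHom ((towerR π).toD.map φ)) (hF : IsIso ((towerR π).toF0.map φ)) :
    IsIrreducibleHom φ :=
  (towerR π).isIrreducibleHom_of_fst_pattern (isIso_and_isIso_of_isIso_comp R0.isTotallyEpimorphic')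
    (fun _ _ ψ => R.isIso_of_isIso_proj π ψ) φ hD' hF

/-- **Prop. 3.4 (v), third pattern, for `R`** — unconditional in `D`.
[cite: MochizukiFrdII2008, Prop 3.4 (v) p.30] -/
theorem R.isIrreducibleHom_of_third_pattern {X Y : R π} (φ : X ⟶ Y)
    (hD' : IsIrreducibleHom ((towerR π).toD.map φ)) (hF : IsIrreducibleHom ((towerR π).toF0.map φ))
    (hD0 : ¬ IsIso ((towerR π).toD0.map φ)) : IsIrreducibleHom φ :=
  (towerR π).isIrreducibleHom_of_third_pattern (fun _ _ ψ => R.isIso_of_isIso_proj π ψ)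
    (fun _ _ ψ => R.isIso_toD0_of_isIso_base0 π ψ) φ hD' hF hD0

/-- **Proposition 3.4 (v) for `F = R`**, for a totally epimorphic base category `D`.
[cite: MochizukiFrdII2008, Prop 3.4 (v) p.30] -/
theorem R.propV (hD : IsTotallyEpimorphic D) : (towerR π).PropV :=
  (towerR π).propV_of_isIso_criteria (isIso_and_isIso_of_isIso_comp R0.isTotallyEpimorphic')
    (isIso_and_isIso_of_isIso_comp hD) (fun _ _ ψ => R.isIso_of_isIso_proj π ψ)
    (fun _ _ ψ => R.isIso_toD0_of_isIso_base0 π ψ)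

/-! ### Proposition 3.4 (v) for `F = A, N, R` -/

/-- **Proposition 3.4 (v)** PROVED for `F = A, N, R` over a TOTALLY EPIMORPHIC base `D` (Ex. 3.3 (i),
p. 27: "Let `D` be a connected, totally epimorphic category"; only the second projection pattern uses
this hypothesis, through "if a composite is an isomorphism then so are its factors", [FrdI] §0 p. 16).
[cite: MochizukiFrdII2008, Prop 3.4 (v) p.30] -/
theorem prop34_v_of_isTotallyEpimorphic (hD : IsTotallyEpimorphic D) : Prop34_v π :=
  ⟨A.propV π hD, N.propV π hD, R.propV π hD⟩

end ArchFrd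

end Literature.AlgebraicGeometry.Frobenioids
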